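import Literature.AlgebraicGeometry.Resolution.RootAdjunctionRegular
import Literature.AlgebraicGeometry.Resolution.RegularLocalRingsQuotient
import HarnessLib

/-!
# `WeightedInvariant.DescentPerfectToAll`, line `root-of-a-constant`: the Kummer criterion

Route `ResolutionOfSingularities/WeightedInvariant`, crux `DescentPerfectToAll`
(stmt-ResolutionOfSingularities-0549), stub `stub_kummerCriterion` of the lead's skeleton
`work/DescentPerfectToAll.lean` (the card's FIRST LEMMA, the `ν ≤ 1` criterion), PROVED here
(statement verbatim from the ledger registration).

**Statement.** Let `(O, 𝔪, κ)` be a regular local ring of prime characteristic `p` and `a ∈ O`.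
The constant Kummer cover `B = O[T]/(T^p - a)` is a regular local ring iff `a` is not a `p`-th
power modulo `𝔪²`, i.e. `∀ c, a - c^p ∉ 𝔪²`.

**Proof.** `B` is finite free over `O` (`T^p - a` is monic), Noetherian, integral over the domain
`O` with `O ↪ B`, so `dim B = dim O =: d` and every maximal ideal of `B` lies over `𝔪`.
* *Inert case* `ā ∉ κ^p` (`∀ c, a - c^p ∉ 𝔪`): `T^p - ā` is irreducible over `κ` (Mathlib
  `X_pow_sub_C_irreducible_of_prime`), so `B/𝔪B ≅ κ[T]/(T^p - ā)`
  (`AdjoinRoot.quotAdjoinRootEquivQuotPolynomialQuot`) is a field, `𝔪B` is the unique maximal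
  ideal and it is generated by the `d` generators of `𝔪`: `B` is regular
  (`IsRegularLocalRing.of_spanFinrank_maximalIdeal_le`); the criterion holds since `𝔪² ⊆ 𝔪`.
* *Ramified case* `a - c₀^p ∈ 𝔪`: the substitution `T ↦ T + c₀` (`Polynomial.algEquivAevalXAddC`)
  identifies `B` with `O[T]/(T^p - a')`, `a' = a - c₀^p ∈ 𝔪` (Frobenius is additive), and
  `a - c^p = a' - (c - c₀)^p`; so WLOG `a ∈ 𝔪`. Then `B` is local with `𝔑 = 𝔪B + (t)` (in-tree
  `AdjoinRoot.isLocalRing_and_maximalIdeal_eq`), `t ∉ 𝔑²` (the map `B → κ[ε]`, `T ↦ ε` kills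
  `𝔑²` but not `t`), hence `emb dim B = emb dim B/(t) + 1` (in-tree
  `spanFinrank_maximalIdeal_quotient_add_one`), and `B/(t) ≅ O/(a)`. If `a ∉ 𝔪²` then
  `emb dim O/(a) = d - 1`, so `emb dim B = d = dim B`: regular. If `a ∈ 𝔪²` then
  `emb dim O/(a) ≥ emb dim O = d` (Nakayama), so `emb dim B ≥ d + 1`: not regular. Finally, for
  `a ∈ 𝔪`, `(∀ c, a - c^p ∉ 𝔪²) ↔ a ∉ 𝔪²` (`c ∈ 𝔪` gives `c^p ∈ 𝔪²`, `c ∉ 𝔪` gives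
  `a - c^p ∉ 𝔪`).

Sources: H. Matsumura, *Commutative Ring Theory* (1986), Thm. 14.2 and its proof (embedding
dimension drops by one modulo `x ∈ 𝔪 ∖ 𝔪²`); the criterion itself is folklore (the local
computation behind Kummer/Artin–Schreier covers of regular schemes in characteristic `p`).
Mathlib searched and used: `AdjoinRoot.lift`, `AdjoinRoot.quotAdjoinRootEquivQuotPolynomialQuot`,
`Polynomial.Monic.finite_adjoinRoot`, `X_pow_sub_C_irreducible_of_prime`,
`Ideal.isMaximal_comap_of_isIntegral_of_isMaximal`, `IsLocalRing.of_unique_max_ideal`,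
`Submodule.le_of_le_smul_of_le_jacobson_bot` (Nakayama), `Ideal.spanFinrank_map_le_of_fg`,
`Ideal.spanFinrank_map_eq_of_ringEquiv`, `DualNumber`, `Polynomial.algEquivAevalXAddC`,
`Ideal.quotientEquiv`, `add_pow_char`, `sub_pow_char`; in-tree:
`AdjoinRoot.isLocalRing_and_maximalIdeal_eq` (RootAdjunctionRegular),
`spanFinrank_maximalIdeal_quotient_add_one`, `exists_nat_cast_eq_ringKrullDim`,
`isLocalRing_quotient` (RegularLocalRingsQuotient), `isDomain_of_isRegularLocalRing`,
`maximalIdeal_quotient_eq_map` (RegularLocalRingsProofs),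
`Literature.RingTheory.KrullDimension.ringKrullDim_eq_of_isIntegral`. No new definitions.
-/

-- single-problem summit: the doubled namespace component `ResolutionOfSingularities` is forced
set_option linter.dupNamespace false -- mandated namespace of this single-conjunct summit

noncomputable section

open IsLocalRing Polynomial
open Literature.AlgebraicGeometry.Resolution

namespace Summit.ResolutionOfSingularities.ResolutionOfSingularities.Theorems

namespace KummerCriterion

/-! ## Embedding dimension modulo an element of `𝔪²` -/

/-- If `x ∈ 𝔪²` in a Noetherian local ring `R` then `emb dim R ≤ emb dim R/(x)`: lifts of a
minimal basis of `𝔪/(x)` generate `𝔪` modulo `(x) ⊆ 𝔪²`, hence generate `𝔪` (Nakayama).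
[folklore] -/
theorem spanFinrank_maximalIdeal_le_of_mem_sq {R : Type*} [CommRing R] [IsLocalRing R]
    [IsNoetherianRing R] {x : R} (hx2 : x ∈ (maximalIdeal R) ^ 2)
    [IsLocalRing (R ⧸ Ideal.span {x})] :
    (maximalIdeal R).spanFinrank ≤ (maximalIdeal (R ⧸ Ideal.span {x})).spanFinrank := by
  classical
  set m := maximalIdeal R with hm
  have hx : x ∈ m := Ideal.pow_le_self two_ne_zero hx2
  haveI : Nontrivial (R ⧸ Ideal.span {x}) :=
    Ideal.Quotient.nontrivial_iff.mpr (Ideal.span_singleton_ne_top hx)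
  rw [maximalIdeal_quotient_eq_map (Ideal.span {x})]
  obtain ⟨t, htcard, htspan⟩ := Submodule.FG.exists_span_finset_card_eq_spanFinrank
    (IsNoetherian.noetherian (m.map (Ideal.Quotient.mk (Ideal.span {x}))))
  have hlift : ∀ w ∈ t, ∃ y, y ∈ m ∧ Ideal.Quotient.mk (Ideal.span {x}) y = w := fun w hw =>
    (Ideal.mem_map_iff_of_surjective _ Ideal.Quotient.mk_surjective).mp
      (by rw [← htspan]; exact Submodule.subset_span hw)
  choose! l hlm hl using hlift
  set N : Ideal R := Ideal.span (l '' (t : Set (R ⧸ Ideal.span {x}))) with hN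
  have hNm : N ≤ m := Ideal.span_le.mpr (by rintro _ ⟨w, hw, rfl⟩; exact hlm w hw)
  -- `𝔪 ≤ N + (x) ≤ N + 𝔪²`
  have h1 : m ≤ N ⊔ m • m := by
    intro y hy
    have hy' : Ideal.Quotient.mk (Ideal.span {x}) y ∈
        N.map (Ideal.Quotient.mk (Ideal.span {x})) := by
      have hy'' : Ideal.Quotient.mk (Ideal.span {x}) y ∈ m.map (Ideal.Quotient.mk _) :=
        Ideal.mem_map_of_mem _ hy
      rw [← htspan] at hy''
      refine (Submodule.span_le.mpr ?_) hy''
      intro w hw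
      rw [SetLike.mem_coe, ← hl w hw]
      exact Ideal.mem_map_of_mem _ (Ideal.subset_span ⟨w, hw, rfl⟩)
    rw [← Ideal.mem_comap, Ideal.comap_map_of_surjective _ Ideal.Quotient.mk_surjective,
      ← RingHom.ker_eq_comap_bot, Ideal.mk_ker] at hy'
    refine (sup_le_sup_left ?_ N) hy'
    rw [Ideal.span_le, Set.singleton_subset_iff, SetLike.mem_coe, Ideal.smul_eq_mul, ← pow_two]
    exact hx2
  have h2 : m ≤ N := Submodule.le_of_le_smul_of_le_jacobson_bot (IsNoetherian.noetherian m)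
    (maximalIdeal_le_jacobson ⊥) h1
  calc m.spanFinrank = N.spanFinrank := by rw [le_antisymm h2 hNm]
    _ ≤ (l '' (↑t : Set (R ⧸ Ideal.span {x}))).ncard :=
        Submodule.spanFinrank_span_le_ncard_of_finite (t.finite_toSet.image l)
    _ ≤ (↑t : Set (R ⧸ Ideal.span {x})).ncard := Set.ncard_image_le t.finite_toSet
    _ = t.card := Set.ncard_coe_finset t
    _ = _ := htcard

/-! ## The cover `B = O[T]/(T^n - a)`: dimension, the quotient by `t`, translation -/

/-- In `O[T]/(T^n - a)` the class `t` of `T` satisfies `t ^ n = a`. [folklore] -/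
theorem root_pow_eq {O : Type*} [CommRing O] (n : ℕ) (a : O) :
    AdjoinRoot.root (X ^ n - C a : O[X]) ^ n = AdjoinRoot.of (X ^ n - C a : O[X]) a := by
  have h := AdjoinRoot.eval₂_root (X ^ n - C a : O[X])
  rwa [eval₂_sub, eval₂_X_pow, eval₂_C, sub_eq_zero] at h

/-- `dim O[T]/(T^n - a) = dim O` for a domain `O` and `n ≥ 1`: a finite injective extension.
[folklore] -/
theorem ringKrullDim_adjoinRoot {O : Type*} [CommRing O] [IsDomain O] {n : ℕ} (hn : 0 < n)
    (a : O) : ringKrullDim (AdjoinRoot (X ^ n - C a : O[X])) = ringKrullDim O := by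
  haveI : Module.Finite O (AdjoinRoot (X ^ n - C a : O[X])) :=
    (monic_X_pow_sub_C a hn.ne').finite_adjoinRoot
  exact (Literature.RingTheory.KrullDimension.ringKrullDim_eq_of_isIntegral
    (R := O) (S := AdjoinRoot (X ^ n - C a : O[X]))
    (AdjoinRoot.of.injective_of_degree_ne_zero
      (by rw [degree_X_pow_sub_C hn]; exact_mod_cast hn.ne'))).symm

/-- `(O[T]/(T^n - a))/(t) ≅ O/(a)` for `n ≥ 1`: the map `T ↦ 0` onto `O/(a)` has kernel `(t)`
(write `q = T·q' + q(0)`; `q(0) ∈ (a)` and `a = t^n`). [folklore] -/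
theorem nonempty_quotient_root_ringEquiv {O : Type*} [CommRing O] {n : ℕ} (hn : 0 < n) (a : O) :
    Nonempty ((AdjoinRoot (X ^ n - C a : O[X]) ⧸
      Ideal.span {AdjoinRoot.root (X ^ n - C a : O[X])}) ≃+* O ⧸ Ideal.span {a}) := by
  set g : O[X] := X ^ n - C a with hg
  have h0 : g.eval₂ (Ideal.Quotient.mk (Ideal.span {a})) 0 = 0 := by
    rw [hg, eval₂_sub, eval₂_X_pow, eval₂_C, zero_pow hn.ne', zero_sub, neg_eq_zero,
      Ideal.Quotient.eq_zero_iff_mem]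
    exact Ideal.mem_span_singleton_self a
  have hsurj : Function.Surjective (AdjoinRoot.lift _ 0 h0) := fun y => by
    obtain ⟨r, rfl⟩ := Ideal.Quotient.mk_surjective y
    exact ⟨AdjoinRoot.of g r, AdjoinRoot.lift_of h0⟩
  have hker : RingHom.ker (AdjoinRoot.lift _ 0 h0) = Ideal.span {AdjoinRoot.root g} := by
    refine le_antisymm ?_ ?_
    · intro b hb
      induction b using AdjoinRoot.induction_on with
      | ih q =>
        rw [RingHom.mem_ker, AdjoinRoot.lift_mk, eval₂_at_zero, Ideal.Quotient.eq_zero_iff_mem,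
          Ideal.mem_span_singleton'] at hb
        obtain ⟨r, hr⟩ := hb
        have hq : AdjoinRoot.mk g q =
            AdjoinRoot.root g * AdjoinRoot.mk g q.divX + AdjoinRoot.of g (q.coeff 0) := by
          conv_lhs => rw [← X_mul_divX_add q]
          rw [map_add, map_mul, AdjoinRoot.mk_X, AdjoinRoot.mk_C]
        rw [hq, ← hr, map_mul, ← root_pow_eq n a]
        exact Ideal.add_mem _ (Ideal.mul_mem_right _ _ (Ideal.mem_span_singleton_self _))
          (Ideal.mul_mem_left _ _
            (Ideal.pow_mem_of_mem _ (Ideal.mem_span_singleton_self _) n hn))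
    · rw [Ideal.span_le, Set.singleton_subset_iff, SetLike.mem_coe, RingHom.mem_ker,
        AdjoinRoot.lift_root]
  exact ⟨(Ideal.quotEquivOfEq hker.symm).trans (RingHom.quotientKerEquivOfSurjective hsurj)⟩

/-- The translation `T ↦ T + c` identifies `O[T]/(T^p - a)` with `O[T]/(T^p - (a - c^p))` in
characteristic `p` (`(T + c)^p = T^p + c^p`). [folklore] -/
theorem nonempty_ringEquiv_translate {O : Type*} [CommRing O] (p : ℕ) [Fact p.Prime] [CharP O p]
    (a c : O) :
    Nonempty (AdjoinRoot (X ^ p - C a : O[X]) ≃+* AdjoinRoot (X ^ p - C (a - c ^ p) : O[X])) := by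
  refine ⟨Ideal.quotientEquiv _ _ (algEquivAevalXAddC c).toRingEquiv ?_⟩
  have he : ((algEquivAevalXAddC c).toRingEquiv : O[X] →+* O[X]) (X ^ p - C a) =
      X ^ p - C (a - c ^ p) := by
    change aeval (X + C c) (X ^ p - C a : O[X]) = _
    rw [map_sub, map_pow, aeval_X, aeval_C, algebraMap_eq, add_pow_char, map_sub, map_pow]
    ring
  rw [Ideal.map_span, Set.image_singleton, he]

/-! ## The inert case: `ā` is not a `p`-th power in `κ` -/

/-- **Inert case, locality.** If `a - c^p ∉ 𝔪` for all `c`, then `B = O[T]/(T^p - a)` is local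
with maximal ideal `𝔪B`: `B/𝔪B ≅ κ[T]/(T^p - ā)` is a field since `T^p - ā` is irreducible over
`κ`, and every maximal ideal of the integral extension `B` lies over `𝔪`. [folklore] -/
theorem isLocalRing_of_forall_not_mem {O : Type*} [CommRing O] [IsLocalRing O] {p : ℕ}
    (hp : p.Prime) {a : O} (ha : ∀ c : O, a - c ^ p ∉ maximalIdeal O) :
    ∃ _ : IsLocalRing (AdjoinRoot (X ^ p - C a : O[X])),
      maximalIdeal (AdjoinRoot (X ^ p - C a : O[X])) =
        (maximalIdeal O).map (AdjoinRoot.of (X ^ p - C a : O[X])) := by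
  set g : O[X] := X ^ p - C a with hg
  haveI : Module.Finite O (AdjoinRoot g) := (monic_X_pow_sub_C a hp.ne_zero).finite_adjoinRoot
  letI := Ideal.Quotient.field (maximalIdeal O)
  -- `T^p - ā` is irreducible over `κ`
  have hirr : Irreducible (g.map (Ideal.Quotient.mk (maximalIdeal O))) := by
    have : g.map (Ideal.Quotient.mk (maximalIdeal O)) =
        X ^ p - C (Ideal.Quotient.mk (maximalIdeal O) a) := by
      rw [hg, Polynomial.map_sub, Polynomial.map_pow, map_X, map_C]
    rw [this]
    refine X_pow_sub_C_irreducible_of_prime hp fun b hb => ?_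
    obtain ⟨c, rfl⟩ := Ideal.Quotient.mk_surjective b
    refine ha c ?_
    rw [← Ideal.Quotient.eq_zero_iff_mem, map_sub, map_pow, hb, sub_self]
  -- so `B/𝔪B ≅ κ[T]/(T^p - ā)` is a field and `𝔪B` is the unique maximal ideal
  have hF : IsField ((O ⧸ maximalIdeal O)[X] ⧸
      Ideal.span {g.map (Ideal.Quotient.mk (maximalIdeal O))}) := by
    haveI := Fact.mk hirr
    exact Field.toIsField (AdjoinRoot (g.map (Ideal.Quotient.mk (maximalIdeal O))))
  have hmax : ((maximalIdeal O).map (AdjoinRoot.of g)).IsMaximal :=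
    Ideal.Quotient.maximal_of_isField _ (MulEquiv.isField hF
      (AdjoinRoot.quotAdjoinRootEquivQuotPolynomialQuot (maximalIdeal O) g).toMulEquiv)
  have huniq : ∀ N : Ideal (AdjoinRoot g), N.IsMaximal →
      N = (maximalIdeal O).map (AdjoinRoot.of g) := by
    intro N hN
    refine (hmax.eq_of_le hN.ne_top ?_).symm
    rw [Ideal.map_le_iff_le_comap]
    have : (N.comap (algebraMap O (AdjoinRoot g))).IsMaximal :=
      Ideal.isMaximal_comap_of_isIntegral_of_isMaximal N
    exact (IsLocalRing.eq_maximalIdeal this).ge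
  haveI : IsLocalRing (AdjoinRoot g) := .of_unique_max_ideal ⟨_, hmax, huniq⟩
  exact ⟨inferInstance, huniq _ (maximalIdeal.isMaximal _)⟩

/-- **Inert case ⇒ regular.** If `a - c^p ∉ 𝔪` for all `c`, then `B = O[T]/(T^p - a)` is a
regular local ring: its maximal ideal `𝔪B` is generated by the `dim O = dim B` generators of
`𝔪`. [folklore] -/
theorem isRegularLocalRing_of_forall_not_mem {O : Type*} [CommRing O] [IsRegularLocalRing O]
    {p : ℕ} (hp : p.Prime) {a : O} (ha : ∀ c : O, a - c ^ p ∉ maximalIdeal O) :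
    IsRegularLocalRing (AdjoinRoot (X ^ p - C a : O[X])) := by
  haveI : IsDomain O := isDomain_of_isRegularLocalRing O
  obtain ⟨hloc, hN⟩ := isLocalRing_of_forall_not_mem hp ha
  obtain ⟨d, hd⟩ := exists_nat_cast_eq_ringKrullDim (R := O)
  have hdO : (maximalIdeal O).spanFinrank = d := by
    have := ((isRegularLocalRing_iff O).mp ‹_›).trans hd
    exact_mod_cast this
  refine IsRegularLocalRing.of_spanFinrank_maximalIdeal_le _ ?_
  rw [ringKrullDim_adjoinRoot hp.pos a, hd, hN]
  exact_mod_cast (Ideal.spanFinrank_map_le_of_fg _ (IsNoetherian.noetherian _)).trans hdO.le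

/-! ## The ramified case: `a ∈ 𝔪` -/

/-- For `a ∈ 𝔪` and `n ≥ 2`, the class `t` of `T` in `B = O[T]/(T^n - a)` does not lie in
`(𝔪B + (t))²`: the ring map `B → κ[ε]`, `T ↦ ε` (well defined as `ε^n = 0 = ā`) sends
`𝔪B + (t)` into `(ε)`, whose square vanishes, but `t ↦ ε ≠ 0`. [folklore] -/
theorem root_not_mem_sq {O : Type*} [CommRing O] [IsLocalRing O] {n : ℕ} (hn : 2 ≤ n) {a : O}
    (ha : a ∈ maximalIdeal O) :
    AdjoinRoot.root (X ^ n - C a : O[X]) ∉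
      ((maximalIdeal O).map (AdjoinRoot.of (X ^ n - C a : O[X])) ⊔
        Ideal.span {AdjoinRoot.root (X ^ n - C a : O[X])}) ^ 2 := by
  set g : O[X] := X ^ n - C a with hg
  set i : O →+* DualNumber (ResidueField O) :=
    (algebraMap (ResidueField O) (DualNumber (ResidueField O))).comp (residue O) with hi
  have hε : g.eval₂ i DualNumber.eps = 0 := by
    have h1 : (DualNumber.eps : DualNumber (ResidueField O)) ^ n = 0 := by
      rw [← Nat.sub_add_cancel hn, pow_add, DualNumber.eps_pow_two, mul_zero]
    have h2 : i a = 0 := by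
      rw [hi, RingHom.comp_apply, (residue_eq_zero_iff a).mpr ha, map_zero]
    rw [hg, eval₂_sub, eval₂_X_pow, eval₂_C, h1, h2, sub_zero]
  have hψ : ((maximalIdeal O).map (AdjoinRoot.of g) ⊔ Ideal.span {AdjoinRoot.root g}).map
      (AdjoinRoot.lift i _ hε) ≤ Ideal.span {DualNumber.eps} := by
    rw [Ideal.map_sup, Ideal.map_map, AdjoinRoot.lift_comp_of, Ideal.map_span,
      Set.image_singleton, AdjoinRoot.lift_root]
    refine sup_le ?_ le_rfl
    have hres : (maximalIdeal O).map (residue O) = ⊥ :=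
      (Ideal.map_eq_bot_iff_le_ker _).mpr ker_residue.ge
    rw [hi, ← Ideal.map_map, hres, Ideal.map_bot]
    exact bot_le
  intro hmem
  have h := Ideal.mem_map_of_mem (AdjoinRoot.lift i _ hε) hmem
  rw [Ideal.map_pow, AdjoinRoot.lift_root] at h
  have h' := Ideal.pow_right_mono hψ 2 h
  rw [Ideal.span_singleton_pow, DualNumber.eps_pow_two, Ideal.span_singleton_eq_bot.mpr rfl,
    Ideal.mem_bot] at h'
  have h'' := congrArg TrivSqZeroExt.snd h'
  rw [DualNumber.snd_eps, TrivSqZeroExt.snd_zero] at h''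
  exact one_ne_zero h''

/-- **Ramified case, `a ∈ 𝔪`.** For a regular local ring `O` of dimension `d`, a prime `p`
(any `p ≥ 2` would do) and `a ∈ 𝔪`, `B = O[T]/(T^p - a)` is regular iff `a ∉ 𝔪²`: `B` is local
with `𝔑 = 𝔪B + (t)`, `t ∉ 𝔑²`, so `emb dim B = emb dim B/(t) + 1 = emb dim O/(a) + 1`, which is
`d = dim B` if `a ∉ 𝔪²` and `≥ d + 1` if `a ∈ 𝔪²`. [folklore] -/
theorem isRegularLocalRing_iff_not_mem_sq {O : Type*} [CommRing O] [IsRegularLocalRing O]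
    {p : ℕ} (hp : p.Prime) {a : O} (ha : a ∈ maximalIdeal O) :
    IsRegularLocalRing (AdjoinRoot (X ^ p - C a : O[X])) ↔ a ∉ (maximalIdeal O) ^ 2 := by
  set g : O[X] := X ^ p - C a with hg
  haveI : IsDomain O := isDomain_of_isRegularLocalRing O
  obtain ⟨hloc, hN⟩ := AdjoinRoot.isLocalRing_and_maximalIdeal_eq hp.pos ha
  -- `t ∈ 𝔑 ∖ 𝔑²`
  have ht : AdjoinRoot.root g ∈ maximalIdeal (AdjoinRoot g) := by
    rw [hN]; exact Ideal.mem_sup_right (Ideal.mem_span_singleton_self _)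
  have ht2 : AdjoinRoot.root g ∉ (maximalIdeal (AdjoinRoot g)) ^ 2 := by
    rw [hN]; exact root_not_mem_sq hp.two_le ha
  -- `emb dim B = emb dim B/(t) + 1 = emb dim O/(a) + 1`
  haveI : IsLocalRing (AdjoinRoot g ⧸ Ideal.span {AdjoinRoot.root g}) :=
    isLocalRing_quotient (Ideal.span_singleton_ne_top ht)
  haveI : IsLocalRing (O ⧸ Ideal.span {a}) := isLocalRing_quotient (Ideal.span_singleton_ne_top ha)
  have hB := spanFinrank_maximalIdeal_quotient_add_one ht ht2
  obtain ⟨e⟩ := nonempty_quotient_root_ringEquiv hp.pos a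
  have hBO : (maximalIdeal (AdjoinRoot g ⧸ Ideal.span {AdjoinRoot.root g})).spanFinrank =
      (maximalIdeal (O ⧸ Ideal.span {a})).spanFinrank := by
    rw [← map_ringEquiv_maximalIdeal e, Ideal.spanFinrank_map_eq_of_ringEquiv]
  -- `dim B = dim O = emb dim O =: d`
  obtain ⟨d, hd⟩ := exists_nat_cast_eq_ringKrullDim (R := O)
  have hdO : (maximalIdeal O).spanFinrank = d := by
    have := ((isRegularLocalRing_iff O).mp ‹_›).trans hd
    exact_mod_cast this
  have hdB : ringKrullDim (AdjoinRoot g) = d := (ringKrullDim_adjoinRoot hp.pos a).trans hd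
  constructor
  · intro hreg ha2
    have h1 : (maximalIdeal (AdjoinRoot g)).spanFinrank = d := by
      have := ((isRegularLocalRing_iff (AdjoinRoot g)).mp hreg).trans hdB
      exact_mod_cast this
    have h2 := spanFinrank_maximalIdeal_le_of_mem_sq ha2
    omega
  · intro ha2
    have h2 := spanFinrank_maximalIdeal_quotient_add_one ha ha2
    refine IsRegularLocalRing.of_spanFinrank_maximalIdeal_le _ ?_
    have h3 : (maximalIdeal (AdjoinRoot g)).spanFinrank = d := by omega
    rw [hdB, h3]

/-- For `a ∈ 𝔪` and `p ≥ 2`: `(∀ c, a - c^p ∉ 𝔪²) ↔ a ∉ 𝔪²` (`c = 0` one way; the other way,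
`c ∈ 𝔪` gives `c^p ∈ 𝔪^p ⊆ 𝔪²`, and `c ∉ 𝔪` gives `a - c^p ∉ 𝔪`). [folklore] -/
theorem forall_sub_pow_not_mem_sq_iff {O : Type*} [CommRing O] [IsLocalRing O] {p : ℕ}
    (hp : 2 ≤ p) {a : O} (ha : a ∈ maximalIdeal O) :
    (∀ c : O, a - c ^ p ∉ (maximalIdeal O) ^ 2) ↔ a ∉ (maximalIdeal O) ^ 2 := by
  constructor
  · intro h
    simpa [zero_pow (by omega : p ≠ 0)] using h 0
  · intro h c hc
    by_cases hcm : c ∈ maximalIdeal O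
    · apply h
      have hcp : c ^ p ∈ (maximalIdeal O) ^ 2 :=
        Ideal.pow_le_pow_right hp (Ideal.pow_mem_pow hcm p)
      simpa using Ideal.add_mem _ hc hcp
    · apply hcm
      have h1 : a - c ^ p ∈ maximalIdeal O := Ideal.pow_le_self two_ne_zero hc
      have h2 : c ^ p ∈ maximalIdeal O := by simpa using Ideal.sub_mem _ ha h1
      exact Ideal.IsPrime.mem_of_pow_mem inferInstance p h2

end KummerCriterion

/-! ## The stub -/

/-- STUB `stub_kummerCriterion` (tool for the one-root step; the card's first lemma, the `ν ≤ 1`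
criterion): for a regular local ring `(O, 𝔪)` of prime characteristic `p` and `a ∈ O`, the
constant Kummer cover `O[T]/(T^p - a)` is a regular local ring iff `a` is not a `p`-th power
modulo `𝔪²`, i.e. `a - c^p ∉ 𝔪²` for every `c`. Inert case (`ā ∉ κ^p`): always regular
(`isRegularLocalRing_of_forall_not_mem`). Ramified case (`a ≡ c₀^p mod 𝔪`): translate
`T ↦ T + c₀` to assume `a ∈ 𝔪` (`nonempty_ringEquiv_translate`), where the cover is regular iff
`a ∉ 𝔪²` (`isRegularLocalRing_iff_not_mem_sq`, `forall_sub_pow_not_mem_sq_iff`). [folklore] -/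
theorem stub_kummerCriterion : ∀ (p : ℕ) [Fact p.Prime] (O : Type) [CommRing O] [IsRegularLocalRing O] [CharP O p] (a : O), IsRegularLocalRing (AdjoinRoot (X ^ p - C a : O[X])) ↔ ∀ c : O, a - c ^ p ∉ (IsLocalRing.maximalIdeal O) ^ 2 := by
  intro p hp O _ _ _ a
  have hp' : p.Prime := hp.out
  by_cases h : ∃ c₀ : O, a - c₀ ^ p ∈ maximalIdeal O
  · -- ramified case: translate to `a ∈ 𝔪`
    obtain ⟨c₀, hc₀⟩ := h
    obtain ⟨e⟩ := KummerCriterion.nonempty_ringEquiv_translate p a c₀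
    have hiff : IsRegularLocalRing (AdjoinRoot (X ^ p - C a : O[X])) ↔
        IsRegularLocalRing (AdjoinRoot (X ^ p - C (a - c₀ ^ p) : O[X])) :=
      ⟨fun _ => IsRegularLocalRing.of_ringEquiv e, fun _ => IsRegularLocalRing.of_ringEquiv e.symm⟩
    rw [hiff, KummerCriterion.isRegularLocalRing_iff_not_mem_sq hp' hc₀,
      ← KummerCriterion.forall_sub_pow_not_mem_sq_iff hp'.two_le hc₀]
    constructor
    · intro H c
      have key : a - c₀ ^ p - (c - c₀) ^ p = a - c ^ p := by rw [sub_pow_char]; ring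
      rw [← key]
      exact H (c - c₀)
    · intro H c
      have key : a - (c + c₀) ^ p = a - c₀ ^ p - c ^ p := by rw [add_pow_char]; ring
      rw [← key]
      exact H (c + c₀)
  · -- inert case: always regular, and the criterion holds since `𝔪² ⊆ 𝔪`
    push Not at h
    exact iff_of_true (KummerCriterion.isRegularLocalRing_of_forall_not_mem hp' h)
      fun c hc => h c (Ideal.pow_le_self two_ne_zero hc)

end Summit.ResolutionOfSingularities.ResolutionOfSingularities.Theorems

end
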